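import Summits.CriticalPhenomena.Ising3DConformalLimit.Theorems.PlantedPinningMoebiusLimitExistsSquareJet
import Summits.CriticalPhenomena.Ising3DConformalLimit.Theorems.PlantedPinningMoebiusLimitExistsJetDoor
import Summits.CriticalPhenomena.Ising3DConformalLimit.Theorems.PlantedPinningMoebiusLimitExistsRegularPolygon
import Summits.CriticalPhenomena.Ising3DConformalLimit.Theorems.PlantedPinningMoebiusLimitExistsRegularPolygonRotation
import Summits.CriticalPhenomena.Ising3DConformalLimit.Theorems.PlantedPinningMoebiusLimitExistsCyclicAveraging
import Summits.CriticalPhenomena.Ising3DConformalLimit.Theorems.PlantedPinningMoebiusLimitExistsInvariantDeriv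
import HarnessLib

/-!
# Order-1 freeness of the Ising₃ Ward-defect jet AT EVERY LEVEL, by transitivity
(crux `MoebiusLimitExists`, stmt-CriticalPhenomena-1344, line `Sketch` v20/v21, lead prover-line-stmt-CriticalPhenomena-1344-c20-0;
THEOREM-ONLY, `--supports stmt-CriticalPhenomena-1344`)

The registered residual 7⁗_jet of skeleton v16–v19 (c19, `…JetDoor.lean`) is the vanishing of the Taylor jet, at ONE configuration
per even level `n ≥ 4`, of the pointwise `K_{e₀}` defect `D_n(x) = DS_n(x)[(‖xᵢ‖²e₀ − 2⟪e₀,xᵢ⟫xᵢ)ᵢ] − 2Δ(Σᵢ⟪e₀,xᵢ⟫)S_n(x)`; c19 proved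
orders `0, 1` FREE at the horizontal square (`n = 4` only, `…SquareJet.lean`).  This file proves ORDER-1 FREENESS AT EVERY LEVEL by
one uniform mechanism — TRANSITIVITY — and records the sharper census:
* `defect_symm_transport` (pure; Z1 + Z2): a linear isometry `R` fixing the generator and mapping `x₀` to its relabelling by `σ`
  transports the defect near `x₀`: `E_b(F)(x₀ + δ) = E_b(F)(x₀ + (R̂δ)∘σ⁻¹)`;
* `limit_fderiv_defectK1_eq_zero_of_cyclicSymmetry`: for every normalised non-degenerate Euclidean scale-covariant limit of
  `criticalCorr 3`, every level `n`, every non-coincident `x₀` in a plane `⊥ e₀` which some `R` with `R e₀ = e₀` maps to its CYCLIC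
  relabelling, `fderiv D_n x₀ = 0`: the covector `DD_n(x₀)` kills the constant-height directions (free zeros II + Y3), is invariant
  under `T δ = (R̂δ)∘σ⁻¹` (transport + N3 p165147), `T` is the cyclic shift on the vertical directions `(hᵢe₀)ᵢ`, so N2 (p165289) kills
  them; every direction is constant-height + vertical;
* at the UNIT REGULAR HORIZONTAL `n`-GON `P_n i = cos(2πi/n)e₁ + sin(2πi/n)e₂` (N1a p165159, N1b p165192): `fderiv D_n P_n = 0` and orders
  `0, 1` of the jet vanish, for EVERY `n` (`limit_jetK1_order_le_one_eq_zero_at_regularPolygon`);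
* census: 7⁗_jet-conclusion ⟺ its order-`≥ 2` part at `P_n` (`jetK1EvenGeFour_iff_jetK1GeTwo_of_limit`); **item 1982 ⟺ the
  order-`≥ 2` jet upgrade** (`inversionUpgradeNormalised_iff_jetK1GeTwoWardUpgrade`); **crux ⟺ 1981 ∧ 7⁗_jet≥2**
  (`MoebiusLimitExists_iff_existence_and_jetK1GeTwoWardStrict`): the registered residual `stub_interiorWardK1JetGeTwo` of skeleton
  v20/v21 is necessary and sufficient given item 1981.  No mechanism for these order-`≥ 2` coefficients is claimed.
References: Di Francesco–Mathieu–Sénéchal 1997 §4.3.1 [FrancescoMathieuSenechal1997]; Glimm–Jaffe 1987 §6.1 [GlimmJaffe1987]; Duminil-Copin ICM 2022 §8.4 [DuminilCopinICM2022]. No defs, no `sorry`.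
-/

noncomputable section

namespace Summit.CriticalPhenomena.Ising3DConformalLimit.MoebiusLimitExistsTransitiveJet

open Filter Topology MeasureTheory Set Function
open Literature.Probability.LatticeModels Literature.MathematicalPhysics.QuantumFieldTheory
open Summit.CriticalPhenomena.Ising3DConformalLimit.Theses
open Summit.CriticalPhenomena.Ising3DConformalLimit.MoebiusLimitExistsSketchV16
open Summit.CriticalPhenomena.Ising3DConformalLimit.MoebiusLimitExistsSketchV20
open Summit.CriticalPhenomena.Ising3DConformalLimit.MoebiusLimitExistsLocalWard (analyticOnNhd_limit analyticOnNhd_defect)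
open Summit.CriticalPhenomena.Ising3DConformalLimit.MoebiusLimitExistsDefectSymmetry (limit_defect_eq_zero_of_coplanar)
open Summit.CriticalPhenomena.Ising3DConformalLimit.Cruxes.InversionUpgradeNormalised.FreeEndpointGaussianClosure
  (isPermutationSymmetric_of_limit)
open Summit.CriticalPhenomena.Ising3DConformalLimit.MoebiusLimitExistsJetDoor
  (jetK1_everywhere_of_jetK1EvenGeFour inversionUpgradeNormalised_iff_jetK1WardUpgrade
    MoebiusLimitExists_iff_existence_and_jetK1WardStrict MoebiusLimitExists_of_existence_of_jetK1WardStrict)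

/-! ## A. Symmetry transport of the defect (pure), and ORDER-1 FREENESS BY TRANSITIVITY for Ising₃ limits -/

/-- **Symmetry transport of the `K_b` defect to a neighbourhood of a symmetric configuration** (pure; Z1 + Z2).  If a linear isometry
`R` fixing the generator `b` maps the configuration `x₀` to its relabelling by `σ` (`R x₀ᵢ = x₀_{σ i}`), then for every
`O(3) × S_n`-invariant level `F` and every displacement `δ`: `E_b(F)(x₀ + δ) = E_b(F)(x₀ + (R̂δ) ∘ σ⁻¹)`. [cite: FrancescoMathieuSenechal1997, §4.1 (4.18)–(4.19)] -/
theorem defect_symm_transport (n : ℕ) (F : (Fin n → EuclideanSpace ℝ (Fin 3)) → ℝ) (Δ : ℝ)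
    (hrot : ∀ (R : EuclideanSpace ℝ (Fin 3) ≃ₗᵢ[ℝ] EuclideanSpace ℝ (Fin 3)) (y : Fin n → EuclideanSpace ℝ (Fin 3)),
      F (fun i => R (y i)) = F y)
    (hperm : ∀ (σ : Equiv.Perm (Fin n)) (y : Fin n → EuclideanSpace ℝ (Fin 3)), F (y ∘ σ) = F y)
    (R : EuclideanSpace ℝ (Fin 3) ≃ₗᵢ[ℝ] EuclideanSpace ℝ (Fin 3)) (σ : Equiv.Perm (Fin n))
    (x₀ : Fin n → EuclideanSpace ℝ (Fin 3)) (hRx : ∀ i, R (x₀ i) = x₀ (σ i))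
    (b : EuclideanSpace ℝ (Fin 3)) (hb : R b = b) (δ : Fin n → EuclideanSpace ℝ (Fin 3)) :
    fderiv ℝ F (x₀ + δ) (fun i => ‖(x₀ + δ) i‖ ^ 2 • b - (2 * inner ℝ b ((x₀ + δ) i)) • (x₀ + δ) i) -
        2 * Δ * (∑ i, inner ℝ b ((x₀ + δ) i)) * F (x₀ + δ) =
      fderiv ℝ F (x₀ + fun i => R (δ (σ.symm i)))
          (fun i => ‖(x₀ + fun i => R (δ (σ.symm i))) i‖ ^ 2 • b -
            (2 * inner ℝ b ((x₀ + fun i => R (δ (σ.symm i))) i)) • (x₀ + fun i => R (δ (σ.symm i))) i) -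
        2 * Δ * (∑ i, inner ℝ b ((x₀ + fun i => R (δ (σ.symm i))) i)) * F (x₀ + fun i => R (δ (σ.symm i))) := by
  set 𝓔 : EuclideanSpace ℝ (Fin 3) → (Fin n → EuclideanSpace ℝ (Fin 3)) → ℝ := fun b' y =>
    fderiv ℝ F y (fun i => ‖y i‖ ^ 2 • b' - (2 * inner ℝ b' (y i)) • y i) - 2 * Δ * (∑ i, inner ℝ b' (y i)) * F y with h𝓔
  -- Z1 at the configuration `x₀ + δ`
  have h1 : 𝓔 (R b) (fun i => R ((x₀ + δ) i)) = 𝓔 b (x₀ + δ) := by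
    have h := stub_defect_rotate n F Δ R (fun y => hrot R y) b (x₀ + δ)
    simpa only [h𝓔, LinearIsometryEquiv.norm_map, LinearIsometryEquiv.inner_map_map] using h
  -- the rotated configuration is the relabelled `x₀ + (R̂δ)∘σ⁻¹`
  have hcfg : (fun i => R ((x₀ + δ) i)) = (x₀ + fun i => R (δ (σ.symm i))) ∘ σ := funext fun i => by
    simp only [Function.comp_apply, Pi.add_apply, map_add, hRx i, Equiv.symm_apply_apply]
  -- Z2
  have h2 : 𝓔 b ((x₀ + fun i => R (δ (σ.symm i))) ∘ σ) = 𝓔 b (x₀ + fun i => R (δ (σ.symm i))) := by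
    have h := stub_defect_perm n F Δ σ (fun y => hperm σ y) b (x₀ + fun i => R (δ (σ.symm i)))
    simpa only [h𝓔] using h
  have h3 : 𝓔 b (x₀ + δ) = 𝓔 b (x₀ + fun i => R (δ (σ.symm i))) := by rw [← h1, hb, hcfg, h2]
  simpa only [h𝓔] using h3

section Limit

variable {ρ : ℝ → ℝ} {Δ : ℝ} {S : CorrFamily 3}

/-- **ORDER-1 FREENESS BY TRANSITIVITY.**  For every normalised non-degenerate Euclidean scale-covariant limit of `criticalCorr 3`,
every level `n`, and every non-coincident configuration `x₀` lying in a plane perpendicular to `e₀` which some linear isometry `R`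
with `R e₀ = e₀` maps to its CYCLIC relabelling (`R x₀ᵢ = x₀_{i+1}`), the Fréchet derivative of the `K_{e₀}` defect of `S n` vanishes
at `x₀`: the covector `DD(x₀)` kills the constant-height directions (free zeros II + Y3), is `T`-invariant for `T δ = (R̂δ)∘σ⁻¹`
(symmetry transport + N3), `T` is the cyclic shift on the vertical directions `(hᵢ e₀)ᵢ`, so N2 kills them; and every direction is
constant-height plus vertical.  No Ward identity is assumed. [cite: FrancescoMathieuSenechal1997, §4.3.1 (4.51)–(4.54)] -/
theorem limit_fderiv_defectK1_eq_zero_of_cyclicSymmetry (hρ : ∀ δ ∈ Set.Ioc (0:ℝ) 1, 0 < ρ δ)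
    (hlim : HasPointwiseScalingLimit (criticalCorr 3) ρ S)
    (hnorm : ∀ n z, z ∉ NonCoincident 3 n → S n z = 0) (hnd : IsNondegenerateTwoPoint S)
    (heuc : IsEuclideanInvariant S) (hsc : IsScaleCovariant Δ S)
    {n : ℕ} {x₀ : Fin n → EuclideanSpace ℝ (Fin 3)} (hx₀ : x₀ ∈ NonCoincident 3 n) (h : ℝ)
    (hplane : ∀ i, inner ℝ (EuclideanSpace.single 0 1 : EuclideanSpace ℝ (Fin 3)) (x₀ i) = h)
    (R : EuclideanSpace ℝ (Fin 3) ≃ₗᵢ[ℝ] EuclideanSpace ℝ (Fin 3))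
    (hR0 : R (EuclideanSpace.single 0 1) = EuclideanSpace.single 0 1) (hRx : ∀ i, R (x₀ i) = x₀ (finRotate n i)) :
    fderiv ℝ (fun x : Fin n → EuclideanSpace ℝ (Fin 3) =>
        fderiv ℝ (S n) x (fun i => ‖x i‖ ^ 2 • (EuclideanSpace.single 0 1 : EuclideanSpace ℝ (Fin 3)) -
          (2 * inner ℝ (EuclideanSpace.single 0 1 : EuclideanSpace ℝ (Fin 3)) (x i)) • x i) -
        2 * Δ * (∑ i, inner ℝ (EuclideanSpace.single 0 1 : EuclideanSpace ℝ (Fin 3)) (x i)) * S n x) x₀ = 0 := by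
  -- notation
  set e0 : EuclideanSpace ℝ (Fin 3) := EuclideanSpace.single 0 1 with he0
  set D : (Fin n → EuclideanSpace ℝ (Fin 3)) → ℝ := fun x =>
    fderiv ℝ (S n) x (fun i => ‖x i‖ ^ 2 • e0 - (2 * inner ℝ e0 (x i)) • x i) - 2 * Δ * (∑ i, inner ℝ e0 (x i)) * S n x with hD
  -- differentiability of `D` at `x₀`
  have hDan : AnalyticOnNhd ℝ D (NonCoincident 3 n) :=
    analyticOnNhd_defect (analyticOnNhd_limit hρ hlim hnorm hnd heuc hsc n) Δ e0
  have hDdiff : DifferentiableAt ℝ D x₀ := (hDan x₀ hx₀).differentiableAt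
  have he0inner : ∀ u : EuclideanSpace ℝ (Fin 3), inner ℝ e0 u = u 0 := fun u => by
    rw [he0, EuclideanSpace.inner_single_left]; simp
  have he0e0 : inner ℝ e0 e0 = (1:ℝ) := by rw [he0inner]; simp [he0]
  -- lines through `x₀` stay non-coincident for small `t`
  have hline : ∀ v : Fin n → EuclideanSpace ℝ (Fin 3), ∀ᶠ t in 𝓝 (0:ℝ), x₀ + t • v ∈ NonCoincident 3 n := fun v => by
    have hc : Tendsto (fun t : ℝ => x₀ + t • v) (𝓝 0) (𝓝 x₀) := by
      have : Continuous fun t : ℝ => x₀ + t • v := continuous_const.add (continuous_id.smul continuous_const)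
      simpa using this.tendsto 0
    exact hc.eventually_mem ((isOpen_nonCoincident 3 n).mem_nhds hx₀)
  -- (I) constant-height directions are killed (free zeros II: `D` vanishes on configurations in planes `⊥ e₀`)
  have hH : ∀ (v : Fin n → EuclideanSpace ℝ (Fin 3)) (c : ℝ), (∀ i, inner ℝ e0 (v i) = c) → fderiv ℝ D x₀ v = 0 :=
      fun v c hv => by
    refine stub_fderiv_apply_eq_zero_of_eventually_line n D x₀ v hDdiff ?_
    filter_upwards [hline v] with t ht
    have hpl : ∀ i, inner ℝ e0 ((x₀ + t • v) i) = h + t * c := fun i => by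
      simp only [Pi.add_apply, Pi.smul_apply, inner_add_right, inner_smul_right, hplane i, hv i]
    exact limit_defect_eq_zero_of_coplanar hρ hlim hnorm hnd heuc hsc ht e0 (h + t * c) hpl
  -- (II) the symmetry `T δ = (R̂ δ) ∘ σ⁻¹`, `σ` the cyclic shift
  set σ : Equiv.Perm (Fin n) := finRotate n with hσ
  set T : (Fin n → EuclideanSpace ℝ (Fin 3)) →L[ℝ] (Fin n → EuclideanSpace ℝ (Fin 3)) :=
    ContinuousLinearMap.pi fun i =>
      (R.toContinuousLinearEquiv : EuclideanSpace ℝ (Fin 3) →L[ℝ] EuclideanSpace ℝ (Fin 3)).comp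
        (ContinuousLinearMap.proj (σ.symm i)) with hT
  have hTfun : ∀ δ : Fin n → EuclideanSpace ℝ (Fin 3), T δ = fun i => R (δ (σ.symm i)) := fun δ => rfl
  have hperm := isPermutationSymmetric_of_limit hlim hnorm
  have hinv : ∀ δ, D (x₀ + δ) = D (x₀ + T δ) := fun δ => by
    have h3 := defect_symm_transport n (S n) Δ (fun R' y => heuc.2 n R' y) (fun τ y => hperm n τ y) R σ x₀ hRx e0 hR0 δ
    rw [hTfun]
    simpa only [hD] using h3
  have hTinv : ∀ δ, fderiv ℝ D x₀ δ = fderiv ℝ D x₀ (T δ) :=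
    stub_fderiv_apply_eq_of_invariant n D x₀ T hDdiff hinv
  -- (III) the vertical functional `ℓ(h) = DD(x₀)[(hᵢ e₀)ᵢ]` is shift invariant and kills `(1,…,1)`, hence vanishes (N2)
  set V : (Fin n → ℝ) → (Fin n → EuclideanSpace ℝ (Fin 3)) := fun hv i => hv i • e0 with hV
  have hVadd : ∀ a a' : Fin n → ℝ, V (a + a') = V a + V a' := fun a a' => funext fun i => by
    simp [hV, add_smul]
  have hVsmul : ∀ (c : ℝ) (a : Fin n → ℝ), V (c • a) = c • V a := fun c a => funext fun i => by
    simp [hV, smul_smul]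
  let ℓ : (Fin n → ℝ) →ₗ[ℝ] ℝ :=
    { toFun := fun hv => fderiv ℝ D x₀ (V hv)
      map_add' := fun a a' => by simp only [hVadd, map_add]
      map_smul' := fun c a => by simp only [hVsmul, map_smul, RingHom.id_apply] }
  have hℓapply : ∀ hv, ℓ hv = fderiv ℝ D x₀ (V hv) := fun _ => rfl
  have hTV : ∀ hv : Fin n → ℝ, T (V hv) = V (hv ∘ σ.symm) := fun hv => funext fun i => by
    simp only [hTfun, hV, Function.comp_apply, map_smul, hR0]
  have hℓrot : ∀ hv : Fin n → ℝ, ℓ (hv ∘ finRotate n) = ℓ hv := fun hv => by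
    rw [hℓapply, hℓapply, hTinv (V (hv ∘ finRotate n)), hTV]
    congr 2
    rw [Function.comp_assoc, ← hσ, Equiv.self_comp_symm, Function.comp_id]
  have hℓone : ℓ (fun _ => 1) = 0 := by
    rw [hℓapply]
    exact hH _ 1 fun i => by simp only [hV, one_smul]; exact he0e0
  have hℓzero : ∀ hv, ℓ hv = 0 := stub_cyclicInvariant_eq_zero n ℓ hℓrot hℓone
  -- (IV) every direction is constant-height + vertical
  refine ContinuousLinearMap.ext fun δ => ?_
  set hv : Fin n → ℝ := fun i => inner ℝ e0 (δ i) with hhv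
  have hsplit : fderiv ℝ D x₀ δ = fderiv ℝ D x₀ (δ - V hv) + fderiv ℝ D x₀ (V hv) := by
    rw [← map_add, sub_add_cancel]
  have hhor : ∀ i, inner ℝ e0 ((δ - V hv) i) = 0 := fun i => by
    simp only [Pi.sub_apply, hV, hhv, inner_sub_right, inner_smul_right, he0e0, mul_one, sub_self]
  rw [hsplit, hH _ 0 hhor, ← hℓapply, hℓzero hv, add_zero]
  simp

/-- **`fderiv` of the `K_{e₀}` defect of `S n` vanishes at the unit regular horizontal `n`-gon**, for every `n` and every normalised
non-degenerate Euclidean scale-covariant limit of `criticalCorr 3` (N1a, N1b feed the transitivity theorem). [cite: FrancescoMathieuSenechal1997, §4.3.1 (4.51)–(4.54)] -/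
theorem limit_fderiv_defectK1_eq_zero_at_regularPolygon (hρ : ∀ δ ∈ Set.Ioc (0:ℝ) 1, 0 < ρ δ)
    (hlim : HasPointwiseScalingLimit (criticalCorr 3) ρ S)
    (hnorm : ∀ n z, z ∉ NonCoincident 3 n → S n z = 0) (hnd : IsNondegenerateTwoPoint S)
    (heuc : IsEuclideanInvariant S) (hsc : IsScaleCovariant Δ S) (n : ℕ) :
    fderiv ℝ (fun x : Fin n → EuclideanSpace ℝ (Fin 3) =>
        fderiv ℝ (S n) x (fun i => ‖x i‖ ^ 2 • (EuclideanSpace.single 0 1 : EuclideanSpace ℝ (Fin 3)) -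
          (2 * inner ℝ (EuclideanSpace.single 0 1 : EuclideanSpace ℝ (Fin 3)) (x i)) • x i) -
        2 * Δ * (∑ i, inner ℝ (EuclideanSpace.single 0 1 : EuclideanSpace ℝ (Fin 3)) (x i)) * S n x)
      (fun i : Fin n => Real.cos (2 * Real.pi * ((i : ℕ) : ℝ) / (n : ℝ)) • (EuclideanSpace.single 1 1 : EuclideanSpace ℝ (Fin 3)) +
        Real.sin (2 * Real.pi * ((i : ℕ) : ℝ) / (n : ℝ)) • (EuclideanSpace.single 2 1 : EuclideanSpace ℝ (Fin 3))) = 0 := by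
  obtain ⟨R, hR0, hRP⟩ := stub_regularPolygon_rotation n
  refine limit_fderiv_defectK1_eq_zero_of_cyclicSymmetry hρ hlim hnorm hnd heuc hsc
    (stub_regularPolygon_mem_nonCoincident n) 0 (fun i => ?_) R hR0 (fun i => hRP i)
  rw [EuclideanSpace.inner_single_left]
  simp

/-- **Orders `0` and `1` of the jet of the `K_{e₀}` defect of `S n` vanish at the unit regular horizontal `n`-gon**, for EVERY level
`n` and every normalised non-degenerate Euclidean scale-covariant limit of `criticalCorr 3`, with no Ward identity assumed: in the jet
form of the crux the conformal content starts at order `2`, at every level. [cite: FrancescoMathieuSenechal1997, §4.3.1 (4.51)–(4.54)] -/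
theorem limit_jetK1_order_le_one_eq_zero_at_regularPolygon (hρ : ∀ δ ∈ Set.Ioc (0:ℝ) 1, 0 < ρ δ)
    (hlim : HasPointwiseScalingLimit (criticalCorr 3) ρ S)
    (hnorm : ∀ n z, z ∉ NonCoincident 3 n → S n z = 0) (hnd : IsNondegenerateTwoPoint S)
    (heuc : IsEuclideanInvariant S) (hsc : IsScaleCovariant Δ S) (n : ℕ) {k : ℕ} (hk : k ≤ 1) :
    iteratedFDeriv ℝ k (fun x : Fin n → EuclideanSpace ℝ (Fin 3) =>
        fderiv ℝ (S n) x (fun i => ‖x i‖ ^ 2 • (EuclideanSpace.single 0 1 : EuclideanSpace ℝ (Fin 3)) -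
          (2 * inner ℝ (EuclideanSpace.single 0 1 : EuclideanSpace ℝ (Fin 3)) (x i)) • x i) -
        2 * Δ * (∑ i, inner ℝ (EuclideanSpace.single 0 1 : EuclideanSpace ℝ (Fin 3)) (x i)) * S n x)
      (fun i : Fin n => Real.cos (2 * Real.pi * ((i : ℕ) : ℝ) / (n : ℝ)) • (EuclideanSpace.single 1 1 : EuclideanSpace ℝ (Fin 3)) +
        Real.sin (2 * Real.pi * ((i : ℕ) : ℝ) / (n : ℝ)) • (EuclideanSpace.single 2 1 : EuclideanSpace ℝ (Fin 3))) = 0 := by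
  interval_cases k
  · -- order 0: the polygon lies in the plane `e₀^⊥` (free zeros II)
    ext m
    rw [iteratedFDeriv_zero_apply]
    refine limit_defect_eq_zero_of_coplanar hρ hlim hnorm hnd heuc hsc (stub_regularPolygon_mem_nonCoincident n)
      (EuclideanSpace.single 0 1) 0 fun i => ?_
    rw [EuclideanSpace.inner_single_left]
    simp
  · -- order 1: `iteratedFDeriv 1 = fderiv`
    ext m
    rw [iteratedFDeriv_one_apply, limit_fderiv_defectK1_eq_zero_at_regularPolygon hρ hlim hnorm hnd heuc hsc n]
    simp

/-- **For these limits, the 7⁗_jet conclusion ⟺ its order-`≥ 2` part at the regular polygon.**  (⇒: a vanishing jet at one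
configuration vanishes at every configuration, `jetK1_everywhere_of_jetK1EvenGeFour`; ⇐: orders `0, 1` at `P_n` are free.)
[cite: GlimmJaffe1987, §6.1 Thm 6.1.3] -/
theorem jetK1EvenGeFour_iff_jetK1GeTwo_of_limit (hρ : ∀ δ ∈ Set.Ioc (0:ℝ) 1, 0 < ρ δ)
    (hlim : HasPointwiseScalingLimit (criticalCorr 3) ρ S)
    (hnorm : ∀ n z, z ∉ NonCoincident 3 n → S n z = 0) (hnd : IsNondegenerateTwoPoint S)
    (heuc : IsEuclideanInvariant S) (hsc : IsScaleCovariant Δ S) :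
    (∀ n, 4 ≤ n → Even n → ∃ x₀ ∈ NonCoincident 3 n, ∀ k : ℕ,
        iteratedFDeriv ℝ k (fun x : Fin n → EuclideanSpace ℝ (Fin 3) =>
          fderiv ℝ (S n) x (fun i => ‖x i‖ ^ 2 • (EuclideanSpace.single 0 1 : EuclideanSpace ℝ (Fin 3)) -
            (2 * inner ℝ (EuclideanSpace.single 0 1 : EuclideanSpace ℝ (Fin 3)) (x i)) • x i) -
          2 * Δ * (∑ i, inner ℝ (EuclideanSpace.single 0 1 : EuclideanSpace ℝ (Fin 3)) (x i)) * S n x) x₀ = 0) ↔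
    (∀ n, 4 ≤ n → Even n → ∀ k : ℕ, 2 ≤ k →
        iteratedFDeriv ℝ k (fun x : Fin n → EuclideanSpace ℝ (Fin 3) =>
          fderiv ℝ (S n) x (fun i => ‖x i‖ ^ 2 • (EuclideanSpace.single 0 1 : EuclideanSpace ℝ (Fin 3)) -
            (2 * inner ℝ (EuclideanSpace.single 0 1 : EuclideanSpace ℝ (Fin 3)) (x i)) • x i) -
          2 * Δ * (∑ i, inner ℝ (EuclideanSpace.single 0 1 : EuclideanSpace ℝ (Fin 3)) (x i)) * S n x)
          (fun i : Fin n => Real.cos (2 * Real.pi * ((i : ℕ) : ℝ) / (n : ℝ)) • (EuclideanSpace.single 1 1 : EuclideanSpace ℝ (Fin 3)) +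
            Real.sin (2 * Real.pi * ((i : ℕ) : ℝ) / (n : ℝ)) • (EuclideanSpace.single 2 1 : EuclideanSpace ℝ (Fin 3))) = 0) :=
  ⟨fun hjet n hn4 he k _ => jetK1_everywhere_of_jetK1EvenGeFour hρ hlim hnorm hnd heuc hsc hjet n hn4 he _
      (stub_regularPolygon_mem_nonCoincident n) k,
    fun h2 n hn4 he => ⟨_, stub_regularPolygon_mem_nonCoincident n, fun k => by
      rcases Nat.lt_or_ge k 2 with hk | hk
      · exact limit_jetK1_order_le_one_eq_zero_at_regularPolygon hρ hlim hnorm hnd heuc hsc n (by omega)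
      · exact h2 n hn4 he k hk⟩⟩

end Limit

/-! ## B. Item 1982 ⟺ the order-`≥ 2` jet upgrade at the regular polygon -/

/-- **Item 1982 ⟺ the order-`≥ 2` jet upgrade**: every normalised non-degenerate Euclidean scale-covariant pointwise limit of the
critical `ℤ³` correlators is inversion covariant iff for every such limit, every even `n ≥ 4` and every `k ≥ 2` the `k`-th iterated
derivative of the `K_{e₀}` defect of `S n` vanishes at the unit regular horizontal `n`-gon. [cite: FrancescoMathieuSenechal1997, §4.3.1 eq. (4.62)] -/
theorem inversionUpgradeNormalised_iff_jetK1GeTwoWardUpgrade :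
    HyperoctahedralRP.InversionUpgradeNormalised ↔
      (∀ (ρ : ℝ → ℝ) (Δ : ℝ) (S : CorrFamily 3), (∀ δ ∈ Set.Ioc (0:ℝ) 1, 0 < ρ δ) →
        HasPointwiseScalingLimit (criticalCorr 3) ρ S → (∀ n z, z ∉ NonCoincident 3 n → S n z = 0) →
        IsNondegenerateTwoPoint S → IsEuclideanInvariant S → IsScaleCovariant Δ S →
        ∀ n, 4 ≤ n → Even n → ∀ k : ℕ, 2 ≤ k →
          iteratedFDeriv ℝ k (fun x : Fin n → EuclideanSpace ℝ (Fin 3) =>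
            fderiv ℝ (S n) x (fun i => ‖x i‖ ^ 2 • (EuclideanSpace.single 0 1 : EuclideanSpace ℝ (Fin 3)) -
              (2 * inner ℝ (EuclideanSpace.single 0 1 : EuclideanSpace ℝ (Fin 3)) (x i)) • x i) -
            2 * Δ * (∑ i, inner ℝ (EuclideanSpace.single 0 1 : EuclideanSpace ℝ (Fin 3)) (x i)) * S n x)
            (fun i : Fin n => Real.cos (2 * Real.pi * ((i : ℕ) : ℝ) / (n : ℝ)) • (EuclideanSpace.single 1 1 : EuclideanSpace ℝ (Fin 3)) +
              Real.sin (2 * Real.pi * ((i : ℕ) : ℝ) / (n : ℝ)) • (EuclideanSpace.single 2 1 : EuclideanSpace ℝ (Fin 3))) = 0) := by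
  rw [inversionUpgradeNormalised_iff_jetK1WardUpgrade]
  refine forall_congr' fun ρ => forall_congr' fun Δ => forall_congr' fun S => forall_congr' fun hρ =>
    forall_congr' fun hlim => forall_congr' fun hnorm => forall_congr' fun hnd => forall_congr' fun heuc =>
    forall_congr' fun hsc => ?_
  exact jetK1EvenGeFour_iff_jetK1GeTwo_of_limit hρ hlim hnorm hnd heuc hsc

/-! ## C. The crux ⟺ item 1981 ∧ 7⁗_jet≥2 (the registered residual of skeleton v20/v21), route spellings -/

/-- **The crux implies 7⁗_jet≥2** (crux ⇒ 7⁗_jet ⇒ the jet vanishes at EVERY configuration, in particular at `P_n` in orders `≥ 2`):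
the residual is necessary. [cite: DuminilCopinICM2022, §8.4] -/
theorem jetK1GeTwoWardStrict_of_MoebiusLimitExists (hcrux : PerfectScreening.MoebiusLimitExists) :
    ∀ (ρ : ℝ → ℝ) (Δ : ℝ) (S : CorrFamily 3), (∀ δ ∈ Set.Ioc (0:ℝ) 1, 0 < ρ δ) →
      HasPointwiseScalingLimit (criticalCorr 3) ρ S → (∀ n z, z ∉ NonCoincident 3 n → S n z = 0) →
      IsNondegenerateTwoPoint S → IsEuclideanInvariant S → IsScaleCovariant Δ S →
      1 / 2 < Δ → Δ ≤ 3 / 4 → HasNontrivialU4 S →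
      (∀ τ : Fin 3, PointwiseOSReconstruction τ S) →
      (∀ (n m : ℕ) (x : Fin n → EuclideanSpace ℝ (Fin 3)) (y : Fin m → EuclideanSpace ℝ (Fin 3))
        (v : EuclideanSpace ℝ (Fin 3)), v ≠ 0 →
        Tendsto (fun t : ℝ => S (n + m) (Fin.append x (fun j => y j + t • v)) - S n x * S m y)
          atTop (𝓝 0)) →
      ∀ n, 4 ≤ n → Even n → ∀ k : ℕ, 2 ≤ k →
        iteratedFDeriv ℝ k (fun x : Fin n → EuclideanSpace ℝ (Fin 3) =>
          fderiv ℝ (S n) x (fun i => ‖x i‖ ^ 2 • (EuclideanSpace.single 0 1 : EuclideanSpace ℝ (Fin 3)) -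
            (2 * inner ℝ (EuclideanSpace.single 0 1 : EuclideanSpace ℝ (Fin 3)) (x i)) • x i) -
          2 * Δ * (∑ i, inner ℝ (EuclideanSpace.single 0 1 : EuclideanSpace ℝ (Fin 3)) (x i)) * S n x)
          (fun i : Fin n => Real.cos (2 * Real.pi * ((i : ℕ) : ℝ) / (n : ℝ)) • (EuclideanSpace.single 1 1 : EuclideanSpace ℝ (Fin 3)) +
            Real.sin (2 * Real.pi * ((i : ℕ) : ℝ) / (n : ℝ)) • (EuclideanSpace.single 2 1 : EuclideanSpace ℝ (Fin 3))) = 0 :=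
  fun ρ Δ S hρ hlim hnorm hnd heuc hsc hlt hle hU4 hos hcl n hn4 he k _ =>
    jetK1_everywhere_of_jetK1EvenGeFour hρ hlim hnorm hnd heuc hsc
      ((MoebiusLimitExists_iff_existence_and_jetK1WardStrict.1 hcrux).2 ρ Δ S hρ hlim hnorm hnd heuc hsc hlt hle hU4 hos hcl)
      n hn4 he _ (stub_regularPolygon_mem_nonCoincident n) k

/-- **TIGHTNESS of skeleton v20/v21: `MoebiusLimitExists ⟺ ExistsScaleCovariantLimit (1981) ∧ 7⁗_jet≥2`** — the reshape
7⁗_jet → 7⁗_jet≥2 (base point `P_n`, orders `0, 1` discharged by §A) drops no content and the residual is necessary. [cite: DuminilCopinICM2022, §8.4] -/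
theorem MoebiusLimitExists_iff_existence_and_jetK1GeTwoWardStrict :
    PerfectScreening.MoebiusLimitExists ↔
      HyperoctahedralRP.ExistsScaleCovariantLimit ∧
      (∀ (ρ : ℝ → ℝ) (Δ : ℝ) (S : CorrFamily 3), (∀ δ ∈ Set.Ioc (0:ℝ) 1, 0 < ρ δ) →
        HasPointwiseScalingLimit (criticalCorr 3) ρ S → (∀ n z, z ∉ NonCoincident 3 n → S n z = 0) →
        IsNondegenerateTwoPoint S → IsEuclideanInvariant S → IsScaleCovariant Δ S →
        1 / 2 < Δ → Δ ≤ 3 / 4 → HasNontrivialU4 S →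
        (∀ τ : Fin 3, PointwiseOSReconstruction τ S) →
        (∀ (n m : ℕ) (x : Fin n → EuclideanSpace ℝ (Fin 3)) (y : Fin m → EuclideanSpace ℝ (Fin 3))
          (v : EuclideanSpace ℝ (Fin 3)), v ≠ 0 →
          Tendsto (fun t : ℝ => S (n + m) (Fin.append x (fun j => y j + t • v)) - S n x * S m y)
            atTop (𝓝 0)) →
        ∀ n, 4 ≤ n → Even n → ∀ k : ℕ, 2 ≤ k →
          iteratedFDeriv ℝ k (fun x : Fin n → EuclideanSpace ℝ (Fin 3) =>
            fderiv ℝ (S n) x (fun i => ‖x i‖ ^ 2 • (EuclideanSpace.single 0 1 : EuclideanSpace ℝ (Fin 3)) -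
              (2 * inner ℝ (EuclideanSpace.single 0 1 : EuclideanSpace ℝ (Fin 3)) (x i)) • x i) -
            2 * Δ * (∑ i, inner ℝ (EuclideanSpace.single 0 1 : EuclideanSpace ℝ (Fin 3)) (x i)) * S n x)
            (fun i : Fin n => Real.cos (2 * Real.pi * ((i : ℕ) : ℝ) / (n : ℝ)) • (EuclideanSpace.single 1 1 : EuclideanSpace ℝ (Fin 3)) +
              Real.sin (2 * Real.pi * ((i : ℕ) : ℝ) / (n : ℝ)) • (EuclideanSpace.single 2 1 : EuclideanSpace ℝ (Fin 3))) = 0) :=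
  ⟨fun hcrux => ⟨MoebiusLimitExistsOnlyInteraction.existsScaleCovariantLimit_of_MoebiusLimitExists hcrux, jetK1GeTwoWardStrict_of_MoebiusLimitExists hcrux⟩,
    fun ⟨hE, h7⟩ => MoebiusLimitExists_of_existence_of_jetK1WardStrict hE
      fun ρ Δ S hρ hlim hnorm hnd heuc hsc hlt hle hU4 hos hcl n hn4 he =>
        ⟨_, stub_regularPolygon_mem_nonCoincident n, fun k => by
          rcases Nat.lt_or_ge k 2 with hk | hk
          · exact limit_jetK1_order_le_one_eq_zero_at_regularPolygon hρ hlim hnorm hnd heuc hsc n (by omega)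
          · exact h7 ρ Δ S hρ hlim hnorm hnd heuc hsc hlt hle hU4 hos hcl n hn4 he k hk⟩⟩


/-- **The crux ⇐ item 1981 ∧ 7⁗_jet≥2** (the composition of skeleton v20/v21). [cite: DuminilCopinICM2022, §8.4] -/
theorem MoebiusLimitExists_of_existence_of_jetK1GeTwoWardStrict (hE : HyperoctahedralRP.ExistsScaleCovariantLimit)
    (h7 : (∀ (ρ : ℝ → ℝ) (Δ : ℝ) (S : CorrFamily 3), (∀ δ ∈ Set.Ioc (0:ℝ) 1, 0 < ρ δ) →
        HasPointwiseScalingLimit (criticalCorr 3) ρ S → (∀ n z, z ∉ NonCoincident 3 n → S n z = 0) →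
        IsNondegenerateTwoPoint S → IsEuclideanInvariant S → IsScaleCovariant Δ S →
        1 / 2 < Δ → Δ ≤ 3 / 4 → HasNontrivialU4 S →
        (∀ τ : Fin 3, PointwiseOSReconstruction τ S) →
        (∀ (n m : ℕ) (x : Fin n → EuclideanSpace ℝ (Fin 3)) (y : Fin m → EuclideanSpace ℝ (Fin 3))
          (v : EuclideanSpace ℝ (Fin 3)), v ≠ 0 →
          Tendsto (fun t : ℝ => S (n + m) (Fin.append x (fun j => y j + t • v)) - S n x * S m y)
            atTop (𝓝 0)) →
        ∀ n, 4 ≤ n → Even n → ∀ k : ℕ, 2 ≤ k →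
          iteratedFDeriv ℝ k (fun x : Fin n → EuclideanSpace ℝ (Fin 3) =>
            fderiv ℝ (S n) x (fun i => ‖x i‖ ^ 2 • (EuclideanSpace.single 0 1 : EuclideanSpace ℝ (Fin 3)) -
              (2 * inner ℝ (EuclideanSpace.single 0 1 : EuclideanSpace ℝ (Fin 3)) (x i)) • x i) -
            2 * Δ * (∑ i, inner ℝ (EuclideanSpace.single 0 1 : EuclideanSpace ℝ (Fin 3)) (x i)) * S n x)
            (fun i : Fin n => Real.cos (2 * Real.pi * ((i : ℕ) : ℝ) / (n : ℝ)) • (EuclideanSpace.single 1 1 : EuclideanSpace ℝ (Fin 3)) +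
              Real.sin (2 * Real.pi * ((i : ℕ) : ℝ) / (n : ℝ)) • (EuclideanSpace.single 2 1 : EuclideanSpace ℝ (Fin 3))) = 0)) :
    PerfectScreening.MoebiusLimitExists :=
  MoebiusLimitExists_iff_existence_and_jetK1GeTwoWardStrict.2 ⟨hE, h7⟩

/-- Route PlantedPinning's spelling of the sufficiency direction. [cite: DuminilCopinICM2022, §8.4] -/
theorem plantedPinning_MoebiusLimitExists_of_existence_of_jetK1GeTwoWardStrict
    (hE : HyperoctahedralRP.ExistsScaleCovariantLimit) (h7 : (∀ (ρ : ℝ → ℝ) (Δ : ℝ) (S : CorrFamily 3), (∀ δ ∈ Set.Ioc (0:ℝ) 1, 0 < ρ δ) →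
        HasPointwiseScalingLimit (criticalCorr 3) ρ S → (∀ n z, z ∉ NonCoincident 3 n → S n z = 0) →
        IsNondegenerateTwoPoint S → IsEuclideanInvariant S → IsScaleCovariant Δ S →
        1 / 2 < Δ → Δ ≤ 3 / 4 → HasNontrivialU4 S →
        (∀ τ : Fin 3, PointwiseOSReconstruction τ S) →
        (∀ (n m : ℕ) (x : Fin n → EuclideanSpace ℝ (Fin 3)) (y : Fin m → EuclideanSpace ℝ (Fin 3))
          (v : EuclideanSpace ℝ (Fin 3)), v ≠ 0 →
          Tendsto (fun t : ℝ => S (n + m) (Fin.append x (fun j => y j + t • v)) - S n x * S m y)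
            atTop (𝓝 0)) →
        ∀ n, 4 ≤ n → Even n → ∀ k : ℕ, 2 ≤ k →
          iteratedFDeriv ℝ k (fun x : Fin n → EuclideanSpace ℝ (Fin 3) =>
            fderiv ℝ (S n) x (fun i => ‖x i‖ ^ 2 • (EuclideanSpace.single 0 1 : EuclideanSpace ℝ (Fin 3)) -
              (2 * inner ℝ (EuclideanSpace.single 0 1 : EuclideanSpace ℝ (Fin 3)) (x i)) • x i) -
            2 * Δ * (∑ i, inner ℝ (EuclideanSpace.single 0 1 : EuclideanSpace ℝ (Fin 3)) (x i)) * S n x)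
            (fun i : Fin n => Real.cos (2 * Real.pi * ((i : ℕ) : ℝ) / (n : ℝ)) • (EuclideanSpace.single 1 1 : EuclideanSpace ℝ (Fin 3)) +
              Real.sin (2 * Real.pi * ((i : ℕ) : ℝ) / (n : ℝ)) • (EuclideanSpace.single 2 1 : EuclideanSpace ℝ (Fin 3))) = 0)) :
    PlantedPinning.MoebiusLimitExists :=
  MoebiusLimitExists_of_existence_of_jetK1GeTwoWardStrict hE h7

/-- The primary host route's spelling `EnergyNotSigmaSquared.MoebiusLimit` of the tightness equivalence. [cite: DuminilCopinICM2022, §8.4] -/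
theorem energyNotSigmaSquared_MoebiusLimit_iff_existence_and_jetK1GeTwoWardStrict :
    EnergyNotSigmaSquared.MoebiusLimit ↔ HyperoctahedralRP.ExistsScaleCovariantLimit ∧ (∀ (ρ : ℝ → ℝ) (Δ : ℝ) (S : CorrFamily 3), (∀ δ ∈ Set.Ioc (0:ℝ) 1, 0 < ρ δ) →
        HasPointwiseScalingLimit (criticalCorr 3) ρ S → (∀ n z, z ∉ NonCoincident 3 n → S n z = 0) →
        IsNondegenerateTwoPoint S → IsEuclideanInvariant S → IsScaleCovariant Δ S →
        1 / 2 < Δ → Δ ≤ 3 / 4 → HasNontrivialU4 S →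
        (∀ τ : Fin 3, PointwiseOSReconstruction τ S) →
        (∀ (n m : ℕ) (x : Fin n → EuclideanSpace ℝ (Fin 3)) (y : Fin m → EuclideanSpace ℝ (Fin 3))
          (v : EuclideanSpace ℝ (Fin 3)), v ≠ 0 →
          Tendsto (fun t : ℝ => S (n + m) (Fin.append x (fun j => y j + t • v)) - S n x * S m y)
            atTop (𝓝 0)) →
        ∀ n, 4 ≤ n → Even n → ∀ k : ℕ, 2 ≤ k →
          iteratedFDeriv ℝ k (fun x : Fin n → EuclideanSpace ℝ (Fin 3) =>
            fderiv ℝ (S n) x (fun i => ‖x i‖ ^ 2 • (EuclideanSpace.single 0 1 : EuclideanSpace ℝ (Fin 3)) -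
              (2 * inner ℝ (EuclideanSpace.single 0 1 : EuclideanSpace ℝ (Fin 3)) (x i)) • x i) -
            2 * Δ * (∑ i, inner ℝ (EuclideanSpace.single 0 1 : EuclideanSpace ℝ (Fin 3)) (x i)) * S n x)
            (fun i : Fin n => Real.cos (2 * Real.pi * ((i : ℕ) : ℝ) / (n : ℝ)) • (EuclideanSpace.single 1 1 : EuclideanSpace ℝ (Fin 3)) +
              Real.sin (2 * Real.pi * ((i : ℕ) : ℝ) / (n : ℝ)) • (EuclideanSpace.single 2 1 : EuclideanSpace ℝ (Fin 3))) = 0) :=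
  MoebiusLimitExists_iff_existence_and_jetK1GeTwoWardStrict

/-! ## Registered anchor -/

/-- **Registered anchor of this file — `fderiv` of the `K_{e₀}` Ward defect of the Ising₃ `n`-point limit vanishes at the unit regular
horizontal `n`-gon, for every `n`** (explicit-binder form of `limit_fderiv_defectK1_eq_zero_at_regularPolygon`). [cite: FrancescoMathieuSenechal1997, §4.3.1 (4.51)–(4.54)] -/
theorem limit_sctDefectK1_fderiv_eq_zero_at_regularPolygon : ∀ (ρ : ℝ → ℝ) (Δ : ℝ) (S : Literature.Probability.LatticeModels.CorrFamily 3), (∀ δ ∈ Set.Ioc (0:ℝ) 1, 0 < ρ δ) → Literature.Probability.LatticeModels.HasPointwiseScalingLimit (Literature.Probability.LatticeModels.criticalCorr 3) ρ S → (∀ n z, z ∉ Literature.Probability.LatticeModels.NonCoincident 3 n → S n z = 0) → Literature.Probability.LatticeModels.IsNondegenerateTwoPoint S → Literature.Probability.LatticeModels.IsEuclideanInvariant S → Literature.Probability.LatticeModels.IsScaleCovariant Δ S → ∀ n : ℕ, fderiv ℝ (fun x : Fin n → EuclideanSpace ℝ (Fin 3) => fderiv ℝ (S n) x (fun i => ‖x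 i‖ ^ 2 • (EuclideanSpace.single 0 1 : EuclideanSpace ℝ (Fin 3)) - (2 * inner ℝ (EuclideanSpace.single 0 1 : EuclideanSpace ℝ (Fin 3)) (x i)) • x i) - 2 * Δ * (∑ i, inner ℝ (EuclideanSpace.single 0 1 : EuclideanSpace ℝ (Fin 3)) (x i)) * S n x) (fun i : Fin n => Real.cos (2 * Real.pi * ((i : ℕ) : ℝ) / (n : ℝ)) • (EuclideanSpace.single 1 1 : EuclideanSpace ℝ (Fin 3)) + Real.sin (2 * Real.pi * ((i : ℕ) : ℝ) / (n : ℝ)) • (EuclideanSpace.single 2 1 : EuclideanSpace ℝ (Fin 3))) = 0 :=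
  fun _ _ _ hρ hlim hnorm hnd heuc hsc n => limit_fderiv_defectK1_eq_zero_at_regularPolygon hρ hlim hnorm hnd heuc hsc n

end Summit.CriticalPhenomena.Ising3DConformalLimit.MoebiusLimitExistsTransitiveJet

end
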